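import Mathlib.Analysis.LocallyConvex.SeparatingDual
import Mathlib.Topology.Maps.OpenQuotient
import Mathlib.Topology.VectorBundle.Basic
import Literature.AlgebraicTopology.CharacteristicClasses.ProjectivizationCharts
import HarnessLib

/-!
# Projective space of a normed space with separating dual: Hausdorffness and the tautological line bundle as a cocycle

Topic `Literature/AlgebraicTopology/CharacteristicClasses`. The tree topologises Mathlib's
`ℙ K V` (`Projectivization.instTopologicalSpace`, `NumberTheory/Transcendental/ProjectiveSpace`),
proves it Hausdorff and compact for FINITE-dimensional `V` (`t2Space_of_finiteDimensional`,
`compactSpace_of_finiteDimensional`, `ProjectivizationCharts`), gives the functional charts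
`chartDomain φ = {[v] | φ v ≠ 0}` with normalised representative `affineRep φ [v] = (φ v)⁻¹ v`
(`ProjectivizationCharts`), and the tautological line bundle of a finite-dimensional `V` with the
lines themselves as fibres (`projTautologicalLineBundle`, `ProjectiveTautologicalBundle`).

The classifying space of LINE bundles over arbitrary paracompact bases is the projective space
of an INFINITE-dimensional Hilbert space (Husemoller, *Fibre Bundles*, Ch. 3 §7: `P^∞`), so the
uniqueness theorem for Chern classes (`TopologicalChernClassesUniqueness`) needs `ℙ 𝕜 V` for a
general normed `V` whose continuous functionals separate points (`SeparatingDual 𝕜 V`: every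
normed space over `ℝ`, `ℂ`). This file provides, in that generality:

* `Projectivization.instT2Space` — **`ℙ 𝕜 V` is Hausdorff**: the relation "same line" on pairs
  of non-zero vectors is the closed set `⋂_{φ, ψ} {φ(v)ψ(w) = ψ(v)φ(w)}` and `mk` is an open
  quotient map (`Projectivization.isOpenQuotientMap_mk`);
* `tautologicalLineCore 𝕜 V : VectorBundleCore 𝕜 (ℙ 𝕜 V) 𝕜 (StrongDual 𝕜 V)` — **the
  tautological line bundle `{([v], u) | u ∈ 𝕜 v}` presented by its cocycle** on the functional
  charts: over `U_φ = chartDomain φ` a vector `u` of the line `[v]` has the coordinate `φ u`, and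
  the coordinate change from `U_φ` to `U_ψ` is multiplication by `ψ(affineRep φ [v]) = ψ v / φ v`
  (Hirzebruch, *Topological Methods*, §4.2: the cocycle `zᵢ/zⱼ` of `ℂⁿ⁺¹ ∖ 0 → P_n(ℂ)`,
  "associated to `η_n⁻¹`", the tautological = inverse hyperplane bundle; Husemoller Ch. 17 §2;
  Milnor–Stasheff §14, `γ¹`). Mathlib's `VectorBundleCore` then supplies total space, topology
  and the `FiberBundle`/`VectorBundle 𝕜 𝕜` instances; the fibre over `p` is the abstract `𝕜`,
  read in the distinguished chart `indexAt p` (some functional not vanishing on `p`).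
  For finite-dimensional `V` this bundle is isomorphic to `projTautologicalLineBundle V` (same
  charts and cocycle); the comparison is not needed and not made here.

Everything is proved; no named facts.

## References

* [Hirzebruch1966] F. Hirzebruch, *Topological Methods in Algebraic Geometry* (1966), §4.2.
* [HusemollerFibreBundles1994] D. Husemoller, *Fibre Bundles*, 3rd ed. (1994), Ch. 3 §7, Ch. 17 §2.
* [MilnorStasheffAMS76] J. Milnor, J. Stasheff, *Characteristic Classes* (1974), §14.
-/

noncomputable section

open Function Set Filter Topology
open scoped LinearAlgebra.Projectivization

/-! ### Hausdorffness -/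

namespace Projectivization

variable {𝕜 : Type*} [NontriviallyNormedField 𝕜] {V : Type*} [NormedAddCommGroup V]
  [NormedSpace 𝕜 V]

/-- **Projective space is Hausdorff** when continuous functionals separate points (all normed
spaces over `ℝ` or `ℂ`, in any dimension): two non-zero vectors span the same line iff
`φ(v)ψ(w) = ψ(v)φ(w)` for all continuous functionals `φ, ψ`, a closed condition, and `mk` is an
open quotient map. A new instance on Mathlib's type (the tree has the finite-dimensional cases
`Projectivization.t2Space_pi`, `t2Space_of_finiteDimensional` as theorems), a deliberate
extension of the `Projectivization` namespace. [folklore] -/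
instance instT2Space [SeparatingDual 𝕜 V] : T2Space (ℙ 𝕜 V) := by
  rw [t2Space_iff_of_isOpenQuotientMap isOpenQuotientMap_mk]
  have key : {q : {v : V // v ≠ 0} × {v : V // v ≠ 0} |
      Projectivization.mk 𝕜 q.1.1 q.1.2 = Projectivization.mk 𝕜 q.2.1 q.2.2} =
        ⋂ φ : StrongDual 𝕜 V, ⋂ ψ : StrongDual 𝕜 V,
          {q | φ (q.1 : V) * ψ (q.2 : V) = ψ (q.1 : V) * φ (q.2 : V)} := by
    ext ⟨v, w⟩
    simp only [mem_setOf_eq, mem_iInter]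
    rw [Projectivization.mk_eq_mk_iff]
    constructor
    · rintro ⟨a, ha⟩ φ ψ
      rw [← ha, Units.smul_def, map_smul, map_smul, smul_eq_mul, smul_eq_mul]
      ring
    · intro h
      obtain ⟨f, hf⟩ := SeparatingDual.exists_eq_one (R := 𝕜) w.2
      by_cases hu : (v : V) - f v • (w : V) = 0
      · have hfv : f v ≠ 0 := by
          intro h0
          apply v.2
          rwa [h0, zero_smul, sub_zero] at hu
        exact ⟨Units.mk0 (f v) hfv, by
          rw [Units.smul_def, Units.val_mk0]; exact (sub_eq_zero.1 hu).symm⟩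
      · obtain ⟨g, hg⟩ := SeparatingDual.exists_eq_one (R := 𝕜) hu
        have h1 := h (g - g w • f) f
        rw [map_sub, map_smul, smul_eq_mul] at hg
        simp only [FunLike.coe_sub, FunLike.coe_smul, Pi.sub_apply,
          Pi.smul_apply, smul_eq_mul, hf, mul_one, sub_self, mul_zero] at h1
        exact absurd (by linear_combination -hg + h1) (one_ne_zero (α := 𝕜))
  rw [key]
  exact isClosed_iInter fun φ ↦ isClosed_iInter fun ψ ↦ isClosed_eq (by fun_prop) (by fun_prop)

end Projectivization

/-! ### The tautological line bundle as a cocycle on the functional charts -/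

namespace Literature.AlgebraicTopology.CharacteristicClasses

section Tautological

variable {𝕜 : Type*} [NontriviallyNormedField 𝕜] {V : Type*} [NormedAddCommGroup V]
  [NormedSpace 𝕜 V]

/-- Every point of `ℙ 𝕜 V` lies in the chart of some CONTINUOUS functional, when these separate
points. [cite: Hirzebruch1966, §4.2] -/
theorem exists_strongDual_mem_chartDomain [SeparatingDual 𝕜 V] (p : ℙ 𝕜 V) :
    ∃ φ : StrongDual 𝕜 V, p ∈ chartDomain (φ : Module.Dual 𝕜 V) := by
  induction p with
  | h v hv =>
    obtain ⟨φ, hφ⟩ := SeparatingDual.exists_ne_zero (R := 𝕜) hv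
    exact ⟨φ, (mk_mem_chartDomain_iff _ v hv).2 hφ⟩

/-- The cocycle of the tautological line bundle on `[v]`: `ψ (affineRep φ [v]) = ψ v / φ v`.
[cite: Hirzebruch1966, §4.2] -/
theorem apply_affineRep_mk (φ ψ : StrongDual 𝕜 V) (v : V) (hv : v ≠ 0) :
    ψ (affineRep (φ : Module.Dual 𝕜 V) (Projectivization.mk 𝕜 v hv)) = ψ v / φ v := by
  rw [affineRep_mk, map_smul, smul_eq_mul, ContinuousLinearMap.coe_coe, div_eq_inv_mul]

variable (𝕜 V) in
/-- **The tautological line bundle over `ℙ 𝕜 V`, presented by its cocycle** (`{([v], u) | u ∈ 𝕜 v}`;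
Milnor–Stasheff §14, `γ¹`; Husemoller Ch. 17 §2, the canonical line bundle): a
`VectorBundleCore` with fibre `𝕜` and charts indexed by the continuous functionals `φ` — over
`U_φ = chartDomain φ` the vector `u` of the line `[v]` has coordinate `φ u`, so the coordinate
change from `U_φ` to `U_ψ` at `p` is multiplication by `ψ (affineRep φ p)` (`= ψ v / φ v` at
`p = [v]`; Hirzebruch §4.2: the cocycle `zᵢ/zⱼ` "associated to `η_n⁻¹`"). Requires that continuous
functionals separate points (`SeparatingDual`, automatic over `ℝ`, `ℂ`) so that the `U_φ` cover;
`V` may be infinite-dimensional (e.g. a Hilbert space, for the classifying space `ℙ(ℓ²)`).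
[cite: Hirzebruch1966, §4.2] [cite: MilnorStasheffAMS76, §14] -/
def tautologicalLineCore [SeparatingDual 𝕜 V] : VectorBundleCore 𝕜 (ℙ 𝕜 V) 𝕜 (StrongDual 𝕜 V) where
  baseSet φ := chartDomain (φ : Module.Dual 𝕜 V)
  isOpen_baseSet φ := isOpen_chartDomain _ φ.continuous
  indexAt p := Classical.choose (exists_strongDual_mem_chartDomain p)
  mem_baseSet_at p := Classical.choose_spec (exists_strongDual_mem_chartDomain p)
  coordChange φ ψ p := ψ (affineRep (φ : Module.Dual 𝕜 V) p) • ContinuousLinearMap.id 𝕜 𝕜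
  coordChange_self φ p hp x := by
    have h1 := apply_affineRep (φ : Module.Dual 𝕜 V) hp
    rw [ContinuousLinearMap.coe_coe] at h1
    rw [FunLike.coe_smul, Pi.smul_apply, ContinuousLinearMap.id_apply, smul_eq_mul, h1, one_mul]
  continuousOn_coordChange φ ψ :=
    ((ψ.continuous.comp_continuousOn (continuousOn_affineRep _ φ.continuous)).mono
      inter_subset_left).smul continuousOn_const
  coordChange_comp φ ψ χ p hp x := by
    obtain ⟨⟨hφ, hψ⟩, -⟩ := hp
    induction p with
    | h v hv =>
      have hψv : ψ v ≠ 0 := (mk_mem_chartDomain_iff _ v hv).1 hψ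
      simp only [FunLike.coe_smul, Pi.smul_apply, ContinuousLinearMap.id_apply, smul_eq_mul,
        apply_affineRep_mk]
      field_simp

/-- The chart domains of the tautological line bundle are the functional charts `U_φ`.
[cite: Hirzebruch1966, §4.2] -/
@[simp]
theorem tautologicalLineCore_baseSet [SeparatingDual 𝕜 V] (φ : StrongDual 𝕜 V) :
    (tautologicalLineCore 𝕜 V).baseSet φ = chartDomain (φ : Module.Dual 𝕜 V) := rfl

/-- `[v]` lies in the chart `U_φ` of the tautological line bundle iff `φ v ≠ 0`.
[cite: Hirzebruch1966, §4.2] -/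
theorem mk_mem_tautologicalLineCore_baseSet_iff [SeparatingDual 𝕜 V] (φ : StrongDual 𝕜 V) (v : V)
    (hv : v ≠ 0) : Projectivization.mk 𝕜 v hv ∈ (tautologicalLineCore 𝕜 V).baseSet φ ↔ φ v ≠ 0 :=
  Iff.rfl

/-- The coordinate change of the tautological line bundle from `U_φ` to `U_ψ` at `[v]` is
multiplication by `ψ v / φ v`. [cite: Hirzebruch1966, §4.2] -/
@[simp]
theorem tautologicalLineCore_coordChange_apply [SeparatingDual 𝕜 V] (φ ψ : StrongDual 𝕜 V) (v : V)
    (hv : v ≠ 0) (x : 𝕜) :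
    (tautologicalLineCore 𝕜 V).coordChange φ ψ (Projectivization.mk 𝕜 v hv) x = ψ v / φ v * x := by
  change (ψ (affineRep (φ : Module.Dual 𝕜 V) (Projectivization.mk 𝕜 v hv)) •
    ContinuousLinearMap.id 𝕜 𝕜) x = _
  rw [FunLike.coe_smul, Pi.smul_apply, ContinuousLinearMap.id_apply, smul_eq_mul,
    apply_affineRep_mk]

/-- The distinguished chart at `p` does not vanish on `p`: `(indexAt [v]) v ≠ 0`.
[cite: Hirzebruch1966, §4.2] -/
theorem indexAt_apply_ne_zero [SeparatingDual 𝕜 V] (v : V) (hv : v ≠ 0) :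
    (tautologicalLineCore 𝕜 V).indexAt (Projectivization.mk 𝕜 v hv) v ≠ 0 :=
  (mk_mem_chartDomain_iff _ v hv).1 ((tautologicalLineCore 𝕜 V).mem_baseSet_at _)

end Tautological

end Literature.AlgebraicTopology.CharacteristicClasses
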